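import Summits.KontsevichZagierPeriods.KontsevichZagierPeriods.Theorems.BiellipticRealPeriodCell.Negative.Witnesses
import Literature.NumberTheory.Transcendental.SemialgebraicAlgebraicPoints
import Summits.KontsevichZagierPeriods.KontsevichZagierPeriods.Theorems.LogPrimitiveNL.Negative.DimZero

/-!
# `BiellipticRealPeriodCell` (stmt-KontsevichZagierPeriods-18685) — negative knowledge, part 3: rule (2) is load-bearing (modulo the transcendence of one real period)

Support file for the crux `IsogenyCertificates.BiellipticRealPeriodCell` (cdisprove seat, cycle 1;
work file `Cruxes/BiellipticRealPeriodCell/Disproof.lean`, finding F6), over part 1 (`Witnesses`).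
Parts 1–2 show that any derivation of the crux's kernel elements uses an additivity rule
(`KZ.coeffSum`) and moves mass across the hyperplane `x = 0` (`KZ.restrictedEval`, rule (2) OR (3)).
Here the disjunction is resolved: **rule (2), change of variables, is itself necessary**, modulo the
transcendence of the complete elliptic integral `∫₂³ dx/√(−(x²−1)(x²−4)(x²−9))` (Schneider 1937 for
the real period of the elliptic quotient `E₂`; hypothesis `hT`, to be discharged through the tree's
`HuberWustholzManyCurvePeriods_holds` once the integral is identified with a lattice period).

The separating invariant of the CHANGE-OF-VARIABLES-FREE sub-calculus `closure((1a) ∪ (1b) ∪ (3))`: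
restricted evaluation `KZ.restrictedEval W` over the FIRST-COORDINATE windows
`W n = {x : ℝⁿ | ∀ i, i = 0 → x i < 0}` (`W 0 = ℝ⁰`; §8), read MODULO REAL ALGEBRAIC NUMBERS:
* (1a), (1b) have restricted value `0` over any measurable windows (tree,
  `KZ.restrictedEval_eq_zero_of_mem_domainAddRel/integrandAddRel`);
* a Newton–Leibniz pair of level `≥ 1` restricted to the windows is again a Newton–Leibniz pair — the
  window constrains the first coordinate, rule (3) integrates the last one, `(init z) 0 = z 0` — so its
  restricted value is `0` by soundness (§9, `restrictedEval_nl_succ`);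
* a Newton–Leibniz pair of level `0` (band `[a₀,b₀] ⊆ ℝ¹` over the point) has restricted value
  `(F(min(b₀,0)) − F(a₀)) − (F(b₀) − F(a₀))` or `−(F(b₀) − F(a₀))`, ALGEBRAIC: `F, a, b` are
  `ℚ`-semialgebraic and take algebraic values at algebraic points
  (`IsSemialgebraicFunOn.isAlgebraic_apply`; FTC on the clamped interval; Dirac volume on `ℝ⁰`)
  (§10, `restrictedEval_nl_zero_isAlgebraic`);
* hence every element of `closure((1a) ∪ (1b) ∪ (3))` has algebraic restricted value
  (§11, `isAlgebraic_restrictedEval_of_mem_closure_noCoV`): without rule (2) no transcendental amount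
  of mass crosses a coordinate hyperplane;
* the mirror pair `[K₊, 1/√F₀] − [K₋, 1/√F₀]` of part 1 has value `0` and restricted value
  `−∫₂³ dx/√F₀` (§12), so `false_without_changeOfVariables_of_transcendental`.
No statement of the tree is changed and no definition is introduced. [Kontsevich–Zagier 2001, §1.2]
[folklore]
-/

noncomputable section

open Set MeasureTheory MvPolynomial
open Literature.NumberTheory.Transcendental Literature.ModelTheory.ExponentialFields
open Summit.KontsevichZagierPeriods.KontsevichZagierPeriods.Theses.IsogenyCertificates
open Summit.KontsevichZagierPeriods.HermiteRigidity.GenusTwoCycleTransferNegative (setIntegral_fin_one)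
open Summit.KontsevichZagierPeriods.LiouvilleUnfolding.LogPrimitiveNL.Negative
  (isAlgebraic_of_isSemialgebraicFunOn_fin_zero)

namespace Summit.KontsevichZagierPeriods.IsogenyCertificates.BiellipticRealPeriodCellNegative

/-! ### §8 First-coordinate windows -/

/-- In dimension `k+1` the first-coordinate window is the half-space `{x 0 < 0}`. [folklore] -/
theorem firstWindow_succ (k : ℕ) :
    {x : Fin (k + 1) → ℝ | ∀ i : Fin (k + 1), (i : ℕ) = 0 → x i < 0} = {x | x 0 < 0} := by
  ext x
  simp only [mem_setOf_eq]
  constructor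
  · intro h; exact h 0 rfl
  · intro h i hi
    have : i = 0 := Fin.ext hi
    subst this; exact h

/-- In dimension `0` the window is everything. [folklore] -/
theorem firstWindow_zero : {x : Fin 0 → ℝ | ∀ i : Fin 0, (i : ℕ) = 0 → x i < 0} = univ := by
  ext x; simp only [mem_setOf_eq, mem_univ, iff_true]; intro i; exact i.elim0

/-- The windows are measurable. [folklore] -/
theorem measurableSet_firstWindow (n : ℕ) :
    MeasurableSet {x : Fin n → ℝ | ∀ i : Fin n, (i : ℕ) = 0 → x i < 0} := by
  cases n with
  | zero => rw [firstWindow_zero]; exact MeasurableSet.univ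
  | succ k => rw [firstWindow_succ]; exact measurableSet_lt (measurable_pi_apply 0) measurable_const

/-- The windows are `ℚ`-semialgebraic. [cite: BochnakCosteRoy1998, §2.1] -/
theorem isSemialgebraic_firstWindow (n : ℕ) :
    IsSemialgebraic ℚ {x : Fin n → ℝ | ∀ i : Fin n, (i : ℕ) = 0 → x i < 0} := by
  cases n with
  | zero => rw [firstWindow_zero]; exact isSemialgebraic_univ
  | succ k =>
    rw [firstWindow_succ]
    have h := isSemialgebraic_setOf_eval_lt (k := ℚ) (R := ℝ) (X 0 : MvPolynomial (Fin (k + 1)) ℚ) 0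
    simpa only [aeval_X, map_zero] using h

/-! ### §9 Rule (3) at level `≥ 1` is a restriction-invariant: restricted Newton–Leibniz pairs -/

/-- **A Newton–Leibniz pair of level `k+1` restricted to the first-coordinate windows is again a
Newton–Leibniz pair**, hence its restricted value vanishes (soundness
`KZ.eval_eq_zero_of_mem_newtonLeibnizRel_holds` applied to the restricted pair): rule (3) acts on the
LAST coordinate, the window constrains the FIRST one, and `(init z) 0 = z 0` in dimension `≥ 2`.
[cite: KontsevichZagier2001, §1.2 rule (3)] -/
theorem restrictedEval_nl_succ {k : ℕ} (r : KZ.IntegralRep (k + 1 + 1)) (r' : KZ.IntegralRep (k + 1))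
    (a b : (Fin (k + 1) → ℝ) → ℝ) (F : (Fin (k + 1 + 1) → ℝ) → ℝ)
    (hF : IsSemialgebraicFunOn ℚ r.domain F)
    (ha : IsSemialgebraicFunOn ℚ r'.domain a) (hb : IsSemialgebraicFunOn ℚ r'.domain b)
    (hab : ∀ x ∈ r'.domain, a x ≤ b x)
    (hdom : r.domain = {z | (Fin.init z : Fin (k + 1) → ℝ) ∈ r'.domain ∧ a (Fin.init z) ≤ z (Fin.last (k + 1)) ∧
      z (Fin.last (k + 1)) ≤ b (Fin.init z)})
    (hcont : ∀ x ∈ r'.domain, ContinuousOn (fun t : ℝ => F (Fin.snoc x t)) (Icc (a x) (b x)))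
    (hderiv : ∀ x ∈ r'.domain, ∀ t ∈ Ioo (a x) (b x),
      HasDerivAt (fun s : ℝ => F (Fin.snoc x s)) (r.integrand (Fin.snoc x t)) t)
    (hr' : ∀ x ∈ r'.domain, r'.integrand x = F (Fin.snoc x (b x)) - F (Fin.snoc x (a x))) :
    KZ.restrictedEval (fun n => {x : Fin n → ℝ | ∀ i : Fin n, (i : ℕ) = 0 → x i < 0}) (KZ.of r - KZ.of r') = 0 := by
  -- the restricted pair
  set W₂ : Set (Fin (k + 1 + 1) → ℝ) := {x | ∀ i : Fin (k + 1 + 1), (i : ℕ) = 0 → x i < 0} with hW₂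
  set W₁ : Set (Fin (k + 1) → ℝ) := {x | ∀ i : Fin (k + 1), (i : ℕ) = 0 → x i < 0} with hW₁
  have hW₂s : IsSemialgebraic ℚ W₂ := isSemialgebraic_firstWindow (k + 1 + 1)
  have hW₁s : IsSemialgebraic ℚ W₁ := isSemialgebraic_firstWindow (k + 1)
  set rW := r.restrict (r.domain ∩ W₂) (r.isSemialgebraic_domain.inter hW₂s) inter_subset_left with hrW
  set r'W := r'.restrict (r'.domain ∩ W₁) (r'.isSemialgebraic_domain.inter hW₁s) inter_subset_left with hr'W
  have hmem : KZ.of rW - KZ.of r'W ∈ KZ.newtonLeibnizRel := by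
    refine ⟨k + 1, rW, r'W, a, b, F, hF.mono inter_subset_left (r.isSemialgebraic_domain.inter hW₂s),
      ha.mono inter_subset_left (r'.isSemialgebraic_domain.inter hW₁s),
      hb.mono inter_subset_left (r'.isSemialgebraic_domain.inter hW₁s),
      fun x hx => hab x hx.1, ?_, fun x hx => hcont x hx.1, fun x hx => hderiv x hx.1,
      fun x hx => hr' x hx.1, rfl⟩
    -- the band identity: `(init z) 0 = z 0`
    show r.domain ∩ W₂ = {z | (Fin.init z : Fin (k + 1) → ℝ) ∈ r'.domain ∩ W₁ ∧
      a (Fin.init z) ≤ z (Fin.last (k + 1)) ∧ z (Fin.last (k + 1)) ≤ b (Fin.init z)}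
    ext z
    rw [hdom, hW₂, hW₁, firstWindow_succ, firstWindow_succ]
    simp only [mem_inter_iff, mem_setOf_eq]
    have h0 : Fin.init z 0 = z 0 := rfl
    rw [h0]
    tauto
  have h0 := KZ.eval_eq_zero_of_mem_newtonLeibnizRel_holds hmem
  rw [map_sub, KZ.eval_of, KZ.eval_of] at h0
  rw [map_sub, KZ.restrictedEval_of, KZ.restrictedEval_of]
  exact h0

/-! ### §10 Rule (3) at level `0` has ALGEBRAIC restricted value -/

/-- Every coordinate of `Fin.snoc x t : ℝ¹` (`x ∈ ℝ⁰`) is `t`. [folklore] -/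
theorem snoc_dimZero_apply (x : Fin 0 → ℝ) (t : ℝ) (i : Fin (0 + 1)) :
    (Fin.snoc x t : Fin (0 + 1) → ℝ) i = t := by
  have hi : i = Fin.last 0 := by
    apply Fin.ext
    have h := i.isLt
    simp only [Fin.val_last]
    omega
  subst hi
  simp [Fin.snoc]

/-- A `ℚ`-semialgebraic function on a subset of `ℝ¹` takes algebraic values at algebraic points
`Fin.snoc x t`. [folklore] -/
theorem isAlgebraic_apply_snoc {s : Set (Fin (0 + 1) → ℝ)} {F : (Fin (0 + 1) → ℝ) → ℝ}
    (hF : IsSemialgebraicFunOn ℚ s F) (x : Fin 0 → ℝ) {t : ℝ} (ht : IsAlgebraic ℚ t)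
    (hmem : Fin.snoc x t ∈ s) : IsAlgebraic ℚ (F (Fin.snoc x t)) :=
  hF.isAlgebraic_apply hmem fun i => by rw [snoc_dimZero_apply]; exact ht

/-- Transfer of integrability from `ℝ¹` to `ℝ` (the converse of `integrableOn_fin_one`). [folklore] -/
theorem integrableOn_of_fin_one {g : ℝ → ℝ} {S : Set ℝ}
    (h : IntegrableOn (fun p : Fin 1 → ℝ => g (p 0)) {p | p 0 ∈ S}) : IntegrableOn g S := by
  have hmp := MeasureTheory.volume_preserving_funUnique (Fin 1) ℝ
  have hpre : {p : Fin 1 → ℝ | p 0 ∈ S} = MeasurableEquiv.funUnique (Fin 1) ℝ ⁻¹' S := by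
    ext x
    simp [MeasurableEquiv.funUnique, Fin.default_eq_zero]
  rw [hpre] at h
  exact (hmp.integrableOn_comp_preimage (MeasurableEquiv.measurableEmbedding _)).mp h

/-- **A Newton–Leibniz pair of level `0` has ALGEBRAIC restricted value.** The band is `[a₀, b₀] ⊆ ℝ¹`
over the one-point base (or empty); its part in the window `{x 0 < 0}` is `[a₀, min(b₀,0)]` up to a
null set, where the fundamental theorem of calculus gives `F(min(b₀,0)) − F(a₀)` (or `0`); the base
term is `F(b₀) − F(a₀)`; and the values of the `ℚ`-semialgebraic `F` at the algebraic points `a₀`,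
`b₀`, `min(b₀, 0)` (`a`, `b` are `ℚ`-semialgebraic on `ℝ⁰`: tree
`isAlgebraic_of_isSemialgebraicFunOn_fin_zero`) are algebraic (`IsSemialgebraicFunOn.isAlgebraic_apply`). This is the only place where the first-coordinate window
fails to commute with rule (3), and it fails only by ALGEBRAIC amounts. [cite: KontsevichZagier2001, §1.2 rule (3)] -/
theorem restrictedEval_nl_zero_isAlgebraic (r : KZ.IntegralRep (0 + 1)) (r' : KZ.IntegralRep 0)
    (a b : (Fin 0 → ℝ) → ℝ) (F : (Fin (0 + 1) → ℝ) → ℝ)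
    (hF : IsSemialgebraicFunOn ℚ r.domain F)
    (ha : IsSemialgebraicFunOn ℚ r'.domain a) (hb : IsSemialgebraicFunOn ℚ r'.domain b)
    (hab : ∀ x ∈ r'.domain, a x ≤ b x)
    (hdom : r.domain = {z | (Fin.init z : Fin 0 → ℝ) ∈ r'.domain ∧ a (Fin.init z) ≤ z (Fin.last 0) ∧
      z (Fin.last 0) ≤ b (Fin.init z)})
    (hcont : ∀ x ∈ r'.domain, ContinuousOn (fun t : ℝ => F (Fin.snoc x t)) (Icc (a x) (b x)))
    (hderiv : ∀ x ∈ r'.domain, ∀ t ∈ Ioo (a x) (b x),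
      HasDerivAt (fun s : ℝ => F (Fin.snoc x s)) (r.integrand (Fin.snoc x t)) t)
    (hr' : ∀ x ∈ r'.domain, r'.integrand x = F (Fin.snoc x (b x)) - F (Fin.snoc x (a x))) :
    IsAlgebraic ℚ (KZ.restrictedEval (fun n => {x : Fin n → ℝ | ∀ i : Fin n, (i : ℕ) = 0 → x i < 0})
      (KZ.of r - KZ.of r')) := by
  rw [map_sub, KZ.restrictedEval_of, KZ.restrictedEval_of, firstWindow_succ, firstWindow_zero, inter_univ]
  rcases r'.domain.eq_empty_or_nonempty with hemp | hne
  · -- empty base: both terms vanish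
    have hband : r.domain = ∅ := by
      rw [hdom, hemp]; ext z; simp
    rw [hband, hemp, empty_inter]
    simp only [Measure.restrict_empty, integral_zero_measure, sub_zero]
    exact isAlgebraic_zero
  · -- one-point base
    have huniv : r'.domain = univ := Subsingleton.eq_univ_of_nonempty hne
    set x₀ : Fin 0 → ℝ := fun i => i.elim0 with hx₀def
    have hx₀ : x₀ ∈ r'.domain := by rw [huniv]; trivial
    have hvol : (volume : Measure (Fin 0 → ℝ)) = Measure.dirac x₀ := by
      rw [MeasureTheory.volume_pi]; exact Measure.pi_of_empty _ _
    -- the base term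
    have hI' : ∫ x in r'.domain, r'.integrand x = F (Fin.snoc x₀ (b x₀)) - F (Fin.snoc x₀ (a x₀)) := by
      rw [huniv, Measure.restrict_univ, hvol, integral_dirac, hr' x₀ hx₀]
    have ha₀ : IsAlgebraic ℚ (a x₀) := isAlgebraic_of_isSemialgebraicFunOn_fin_zero ha hx₀
    have hb₀ : IsAlgebraic ℚ (b x₀) := isAlgebraic_of_isSemialgebraicFunOn_fin_zero hb hx₀
    have hab₀ : a x₀ ≤ b x₀ := hab x₀ hx₀
    -- the band in coordinates
    have hinit : ∀ z : Fin (0 + 1) → ℝ, (Fin.init z : Fin 0 → ℝ) = x₀ := fun z => Subsingleton.elim _ _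
    have hlast : (Fin.last 0 : Fin (0 + 1)) = 0 := rfl
    have hband : r.domain = {z : Fin (0 + 1) → ℝ | z 0 ∈ Icc (a x₀) (b x₀)} := by
      rw [hdom]; ext z
      simp only [mem_setOf_eq, hinit z, huniv, mem_univ, true_and, mem_Icc, hlast]
    have hsnoc : ∀ z : Fin (0 + 1) → ℝ, Fin.snoc x₀ (z 0) = z := fun z => by
      have h := Fin.snoc_init_self z
      rw [hinit z, hlast] at h
      exact h
    have hmemband : ∀ t ∈ Icc (a x₀) (b x₀), (Fin.snoc x₀ t : Fin (0 + 1) → ℝ) ∈ r.domain := fun t ht => by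
      rw [hband]; simpa only [mem_setOf_eq, snoc_dimZero_apply] using ht
    have hFa : IsAlgebraic ℚ (F (Fin.snoc x₀ (a x₀))) :=
      isAlgebraic_apply_snoc hF x₀ ha₀ (hmemband _ (left_mem_Icc.2 hab₀))
    have hFb : IsAlgebraic ℚ (F (Fin.snoc x₀ (b x₀))) :=
      isAlgebraic_apply_snoc hF x₀ hb₀ (hmemband _ (right_mem_Icc.2 hab₀))
    -- the band term, read on `ℝ`
    set f : ℝ → ℝ := fun t => r.integrand (Fin.snoc x₀ t) with hfdef
    set m : ℝ := min (b x₀) 0 with hmdef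
    have hm_alg : IsAlgebraic ℚ m := by
      rcases le_total (b x₀) 0 with h | h
      · rw [hmdef, min_eq_left h]; exact hb₀
      · rw [hmdef, min_eq_right h]; exact isAlgebraic_zero
    have hset : r.domain ∩ {x : Fin (0 + 1) → ℝ | x 0 < 0} = {z | z 0 ∈ Icc (a x₀) m \ {0}} := by
      rw [hband]; ext z
      simp only [mem_inter_iff, mem_setOf_eq, mem_Icc, mem_sdiff, mem_singleton_iff, hmdef, le_min_iff]
      constructor
      · rintro ⟨⟨h1, h2⟩, h3⟩; exact ⟨⟨h1, h2, h3.le⟩, h3.ne⟩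
      · rintro ⟨⟨h1, h2, h3⟩, h4⟩; exact ⟨⟨h1, h2⟩, lt_of_le_of_ne h3 h4⟩
    have hI : ∫ z in r.domain ∩ {x : Fin (0 + 1) → ℝ | x 0 < 0}, r.integrand z = ∫ t in Icc (a x₀) m \ {0}, f t := by
      rw [hset, ← setIntegral_fin_one f (Icc (a x₀) m \ {0})]
      refine setIntegral_congr_fun ?_ fun z _ => ?_
      · rw [← hset, hband]
        exact (measurableSet_Icc.preimage (measurable_pi_apply 0)).inter
          (measurableSet_Iio.preimage (measurable_pi_apply 0))
      · simp only [hfdef, hsnoc z]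
    have hnull : (Icc (a x₀) m \ {0} : Set ℝ) =ᵐ[volume] (Icc (a x₀) m : Set ℝ) :=
      sdiff_ae_eq_self.2 (measure_mono_null inter_subset_right (by simp))
    rw [hI, setIntegral_congr_set hnull, hI']
    -- case analysis on the clamped interval
    rcases lt_or_ge m (a x₀) with hlt | hle
    · rw [Icc_eq_empty (not_le.2 hlt), Measure.restrict_empty, integral_zero_measure, zero_sub]
      exact (hFb.sub hFa).neg
    · -- FTC on `[a₀, m] ⊆ [a₀, b₀]`
      have hmb : m ≤ b x₀ := min_le_left _ _
      have hsub : Icc (a x₀) m ⊆ Icc (a x₀) (b x₀) := Icc_subset_Icc le_rfl hmb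
      have hint : IntegrableOn f (Icc (a x₀) (b x₀)) := by
        refine integrableOn_of_fin_one ?_
        have h := r.integrableOn
        rw [hband] at h
        refine (integrableOn_congr_fun (fun z _ => ?_) ?_).1 h
        · simp only [hfdef, hsnoc z]
        · exact measurableSet_Icc.preimage (measurable_pi_apply 0)
      have hFTC : ∫ t in Icc (a x₀) m, f t = F (Fin.snoc x₀ m) - F (Fin.snoc x₀ (a x₀)) := by
        rw [integral_Icc_eq_integral_Ioc, ← intervalIntegral.integral_of_le hle]
        refine intervalIntegral.integral_eq_sub_of_hasDerivAt_of_le hle ((hcont x₀ hx₀).mono hsub)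
          (fun t ht => hderiv x₀ hx₀ t ⟨ht.1, lt_of_lt_of_le ht.2 hmb⟩) ?_
        exact (intervalIntegrable_iff_integrableOn_Icc_of_le hle).2 (hint.mono_set hsub)
      rw [hFTC]
      have hFm : IsAlgebraic ℚ (F (Fin.snoc x₀ m)) := isAlgebraic_apply_snoc hF x₀ hm_alg (hmemband _ ⟨hle, hmb⟩)
      exact (hFm.sub hFa).sub (hFb.sub hFa)

/-! ### §11 The invariant: restricted value modulo algebraic numbers kills (1a), (1b), (3) -/

/-- **Every element of the change-of-variables-free sub-calculus `closure((1a) ∪ (1b) ∪ (3))` has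
ALGEBRAIC restricted value over the first-coordinate windows.** (1a), (1b): restricted value `0`
(`KZ.restrictedEval_eq_zero_of_mem_*`); (3) of level `≥ 1`: `0` (`restrictedEval_nl_succ`); (3) of
level `0`: algebraic (`restrictedEval_nl_zero_isAlgebraic`); closed under `0, +, −`. So without rule (2)
no TRANSCENDENTAL amount of mass ever crosses the hyperplane `x 0 = 0`. [cite: KontsevichZagier2001, §1.2] -/
theorem isAlgebraic_restrictedEval_of_mem_closure_noCoV {c : KZ.FormalRep}
    (hc : c ∈ AddSubgroup.closure (KZ.domainAddRel ∪ KZ.integrandAddRel ∪ KZ.newtonLeibnizRel)) :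
    IsAlgebraic ℚ (KZ.restrictedEval (fun n => {x : Fin n → ℝ | ∀ i : Fin n, (i : ℕ) = 0 → x i < 0}) c) := by
  induction hc using AddSubgroup.closure_induction with
  | mem d hd =>
    rcases hd with (hd | hd) | hd
    · rw [KZ.restrictedEval_eq_zero_of_mem_domainAddRel _ measurableSet_firstWindow hd]
      exact isAlgebraic_zero
    · rw [KZ.restrictedEval_eq_zero_of_mem_integrandAddRel _ measurableSet_firstWindow hd]
      exact isAlgebraic_zero
    · obtain ⟨n, r, r', a, b, F, hF, ha, hb, hab, hdom, hcont, hderiv, hr', rfl⟩ := hd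
      cases n with
      | zero => exact restrictedEval_nl_zero_isAlgebraic r r' a b F hF ha hb hab hdom hcont hderiv hr'
      | succ k =>
        rw [restrictedEval_nl_succ r r' a b F hF ha hb hab hdom hcont hderiv hr']
        exact isAlgebraic_zero
  | zero => rw [map_zero]; exact isAlgebraic_zero
  | add x y _ _ hx hy => rw [map_add]; exact hx.add hy
  | neg x _ hx => rw [map_neg]; exact hx.neg

/-! ### §12 The mirror pair crosses the hyperplane with a transcendental mass -/

/-- The restricted value of the mirror pair `[K₊, 1/√F₀] − [K₋, 1/√F₀]` over the first-coordinate
windows is `−∫₂³ dx/√F₀` (`K₊ = (2,3)` misses `{x < 0}`, `K₋ = (−3,−2)` lies inside). [folklore] -/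
theorem restrictedEval_firstWindow_pair {r r' : KZ.IntegralRep 1} (hd : r.domain = {p | p 0 ∈ Ioo (2:ℝ) 3})
    (hd' : r'.domain = {p | p 0 ∈ Ioo (-3:ℝ) (-2)}) (hi' : r'.integrand = fun p => 1 / Real.sqrt (-((p 0 ^ 2 - 1) * (p 0 ^ 2 - 4) * (p 0 ^ 2 - 9)))) :
    KZ.restrictedEval (fun n => {x : Fin n → ℝ | ∀ i : Fin n, (i : ℕ) = 0 → x i < 0}) (KZ.of r - KZ.of r') =
      -∫ x in Ioo (2:ℝ) 3, 1 / Real.sqrt (-((x ^ 2 - 1) * (x ^ 2 - 4) * (x ^ 2 - 9))) := by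
  rw [map_sub, KZ.restrictedEval_of, KZ.restrictedEval_of]
  have hW : {x : Fin 1 → ℝ | ∀ i : Fin 1, (i : ℕ) = 0 → x i < 0} = {x | x 0 < 0} := firstWindow_succ 0
  have h1 : r.domain ∩ {x : Fin 1 → ℝ | ∀ i : Fin 1, (i : ℕ) = 0 → x i < 0} = ∅ := by
    rw [hd, hW]
    ext x
    simp only [mem_inter_iff, mem_setOf_eq, mem_Ioo, mem_empty_iff_false, iff_false, not_and, not_lt]
    intro hx
    linarith [hx.1]
  have h2 : r'.domain ∩ {x : Fin 1 → ℝ | ∀ i : Fin 1, (i : ℕ) = 0 → x i < 0} = r'.domain := by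
    rw [hW]
    refine inter_eq_left.2 fun x hx => ?_
    rw [hd'] at hx
    have hx' : x 0 ∈ Ioo (-3:ℝ) (-2) := hx
    show x 0 < 0
    linarith [hx'.2]
  rw [h1, h2, Measure.restrict_empty, integral_zero_measure, zero_sub, ← value_left hd' hi']
  rfl

/-- **Rule (2) specifically is load-bearing — modulo the transcendence of one real period.** If the
complete elliptic integral of the first kind `∫₂³ dx/√(−(x²−1)(x²−4)(x²−9))` (half the real period of
the elliptic quotient `E₂ : w² = v³G₀(1/v)`, `G₀ = −(u−1)(u−4)(u−9)`, up to `ℚ×`) is transcendental —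
Schneider 1937; in the tree through `HuberWustholzManyCurvePeriods_holds` once the integral is
identified with a lattice period — then the crux with `KZ.relations` replaced by the subgroup generated
by (1a), (1b), (3) (NO change of variables) is FALSE: the mirror pair `[K₊,1/√F₀] − [K₋,1/√F₀]` has
value `0` (evenness) but TRANSCENDENTAL restricted value `−∫₂³ dx/√F₀` over the first-coordinate
windows, while every element of `closure((1a) ∪ (1b) ∪ (3))` has ALGEBRAIC restricted value
(`isAlgebraic_restrictedEval_of_mem_closure_noCoV`). With `false_without_additivity` and
`false_without_cov_nl` (part 2): any proof of the crux uses an additivity rule AND rule (2).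
[cite: KontsevichZagier2001, §1.2] -/
theorem false_without_changeOfVariables_of_transcendental
    (hT : Transcendental ℚ (∫ x in Ioo (2:ℝ) 3, 1 / Real.sqrt (-((x ^ 2 - 1) * (x ^ 2 - 4) * (x ^ 2 - 9))))) :
    ¬ (∀ c ∈ AddSubgroup.closure {d : KZ.FormalRep | ∃ (G : Polynomial ℚ) (q a₀ a₁ : ℚ) (r : KZ.IntegralRep 1), G.natDegree = 3 ∧ Squarefree (G.comp (Polynomial.X ^ 2)) ∧ 0 < Polynomial.aeval (q : ℝ) (G.comp (Polynomial.X ^ 2)) ∧ Bornology.IsBounded (connectedComponentIn {y : ℝ | 0 < Polynomial.aeval y (G.comp (Polynomial.X ^ 2))} (q : ℝ)) ∧ r.domain = {x | x 0 ∈ connectedComponentIn {y : ℝ | 0 < Polynomial.aeval y (G.comp (Polynomial.X ^ 2))} (q : ℝ)} ∧ Set.EqOn r.integrand (fun x => ((a₀ : ℝ) + (a₁ : ℝ) * x 0) / Real.sqrt (Polynomial.aeval (x 0) (G.comp (Polynomial.X ^ 2)))) r.domain ∧ d = KZ.of r}, KZ.eval c = 0 →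
      c ∈ AddSubgroup.closure (KZ.domainAddRel ∪ KZ.integrandAddRel ∪ KZ.newtonLeibnizRel)) := fun h => by
  obtain ⟨r, hd, hi⟩ := exists_repRight
  obtain ⟨r', hd', hi'⟩ := exists_repLeft
  have hc : KZ.of r - KZ.of r' ∈ AddSubgroup.closure {d : KZ.FormalRep | ∃ (G : Polynomial ℚ) (q a₀ a₁ : ℚ) (r : KZ.IntegralRep 1), G.natDegree = 3 ∧ Squarefree (G.comp (Polynomial.X ^ 2)) ∧ 0 < Polynomial.aeval (q : ℝ) (G.comp (Polynomial.X ^ 2)) ∧ Bornology.IsBounded (connectedComponentIn {y : ℝ | 0 < Polynomial.aeval y (G.comp (Polynomial.X ^ 2))} (q : ℝ)) ∧ r.domain = {x | x 0 ∈ connectedComponentIn {y : ℝ | 0 < Polynomial.aeval y (G.comp (Polynomial.X ^ 2))} (q : ℝ)} ∧ Set.EqOn r.integrand (fun x => ((a₀ : ℝ) + (a₁ : ℝ) * x 0) / Real.sqrt (Polynomial.aeval (x 0) (G.comp (Polynomial.X ^ 2)))) r.domain ∧ d = KZ.of r} :=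
    sub_mem (AddSubgroup.subset_closure ?_) (AddSubgroup.subset_closure ?_)
  rotate_left
  · -- `r₊` is a generator: `G = G₀`, `q = 5/2`, `a₀ = 1`, `a₁ = 0`
    refine ⟨(Polynomial.C (-1) * Polynomial.X ^ 3 + Polynomial.C 14 * Polynomial.X ^ 2 + Polynomial.C (-49) * Polynomial.X + Polynomial.C 36 : Polynomial ℚ), 5/2, 1, 0, r, natDegree_G₀, squarefree_comp_G₀, ?_, isBounded_component_right, ?_, ?_, rfl⟩
    · rw [aeval_F₀]; norm_num
    · rw [component_right, hd]
    · intro x _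
      simp only [aeval_F₀, hi]
      simp
  · -- `r₋` is a generator: `G = G₀`, `q = −5/2`, `a₀ = 1`, `a₁ = 0`
    refine ⟨(Polynomial.C (-1) * Polynomial.X ^ 3 + Polynomial.C 14 * Polynomial.X ^ 2 + Polynomial.C (-49) * Polynomial.X + Polynomial.C 36 : Polynomial ℚ), -5/2, 1, 0, r', natDegree_G₀, squarefree_comp_G₀, ?_, isBounded_component_left, ?_, ?_, rfl⟩
    · rw [aeval_F₀]; norm_num
    · rw [component_left, hd']
    · intro x _
      simp only [aeval_F₀, hi']
      simp
  have h0 : KZ.eval (KZ.of r - KZ.of r') = 0 := by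
    rw [map_sub, KZ.eval_of, KZ.eval_of, value_right hd hi, value_left hd' hi', sub_self]
  have halg := isAlgebraic_restrictedEval_of_mem_closure_noCoV (h _ hc h0)
  rw [restrictedEval_firstWindow_pair hd hd' hi'] at halg
  exact hT (by simpa using halg.neg)

end Summit.KontsevichZagierPeriods.IsogenyCertificates.BiellipticRealPeriodCellNegative
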